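import Summits.Ventures.HodgeRepro2.T5SU11RadialSummaryVIII

/-!
# The resolvent identity `G_λ − G_{λ₂} = (μ − μ₂) G_λ G_{λ₂}` of the radial Laplacian, in ODE form and in the
transform picture

For `λ, λ₂ > 1`, `μ = λ(λ−2)`, `μ₂ = λ₂(λ₂−2)` and a continuous source `f` supported in `[a, b] ⊂ (0, ∞)`, the
difference `w = G_λ f − G_{λ₂} f` of the two Green's solutions (rows 451–452) satisfies

  **`sinh 2t · w″ + 2 cosh 2t · w′ = μ sinh 2t · w + sinh 2t · ((μ − μ₂) G_{λ₂} f)`** (`resolvent_diff_ode`),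

i.e. `(L − μ) w = (μ − μ₂) G_{λ₂} f` — `w` IS `G_λ` applied to the (non-compactly supported) source `(μ − μ₂) G_{λ₂} f`
in the only sense the tree needs: it is bounded at the origin (`eventually_abs_resolvent_diff_le`), decays relative to
`φ_λ` (`tendsto_resolvent_diff_div_atTop`; `G_{λ₂} f/φ_λ → 0` because `χ_{λ₂}/φ_λ ~ e^{(2−λ−λ₂)t}`,
`tendsto_sphDecay_div_sph_hyp_atTop`), and is the UNIQUE such solution (`eq_resolvent_diff_of_ode`; the general
uniqueness statement `eq_of_ode_of_bounded_of_decay`: two solutions of the same inhomogeneous radial equation, bounded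
at `0` and decaying relative to `φ_λ`, coincide — row 446). In the spherical-transform picture (rows 470, 472, 481,
483) the identity reads, for `|λ′ − 1| < min(λ, λ₂) − 1`,

  **`(G_λ f)^(λ′) − (G_{λ₂} f)^(λ′) = (μ − μ₂) · f̂(λ′) / ((μ′ − μ)(μ′ − μ₂))`** (`resolvent_identity_transform`),

the multiplier of `G_λ G_{λ₂}` being the product of the two multipliers `1/(μ′ − μ)`, `1/(μ′ − μ₂)`.

Nothing is claimed about (N).

Blind lane: Mathlib + the HodgeRepro2 prefix only; no sorry; axioms ⊆ {propext, Classical.choice,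
Quot.sound}.
-/

namespace Summit.Ventures.HodgeRepro2.T5SU11ResolventIdentity

open Filter Topology MeasureTheory intervalIntegral
open Set (Ioi)
open T5SU11Cartan T5SU11SphericalFunction T5SU11SphericalBounds T5SU11SphericalContinuous
  T5SU11SphericalAsymptotic T5SU11SphericalCfun T5SU11SphericalSolutionSpaceAll T5SU11SphericalRegular
  T5SU11SphericalDecay T5SU11SphericalDecayAsymptotic T5SU11SphericalGreen T5SU11ResolventDiagonalReflect
  T5SU11RadialSummaryVIII

section measure

variable [MeasurableSpace Circle] [BorelSpace Circle]

/-! ### Uniqueness for the inhomogeneous equation with an arbitrary source -/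

/-- **Two solutions of the same inhomogeneous radial equation, bounded at the origin and decaying relative to
`φ_λ`, coincide on `(0, ∞)`** (the difference is a homogeneous solution, bounded at `0` hence a multiple of `φ_λ`
(row 446), and `o(φ_λ)` at infinity hence zero). -/
theorem eq_of_ode_of_bounded_of_decay (lam : ℝ) {g v v' v'' w w' w'' : ℝ → ℝ}
    (hv : ∀ t, 0 < t → HasDerivAt v (v' t) t) (hv' : ∀ t, 0 < t → HasDerivAt v' (v'' t) t)
    (hvode : ∀ t, 0 < t → Real.sinh (2 * t) * v'' t + 2 * Real.cosh (2 * t) * v' t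
      = lam * (lam - 2) * Real.sinh (2 * t) * v t + Real.sinh (2 * t) * g t)
    (hw : ∀ t, 0 < t → HasDerivAt w (w' t) t) (hw' : ∀ t, 0 < t → HasDerivAt w' (w'' t) t)
    (hwode : ∀ t, 0 < t → Real.sinh (2 * t) * w'' t + 2 * Real.cosh (2 * t) * w' t
      = lam * (lam - 2) * Real.sinh (2 * t) * w t + Real.sinh (2 * t) * g t)
    {B : ℝ} (hB : ∀ᶠ t in 𝓝[>] (0 : ℝ), |v t| ≤ B) {C : ℝ} (hC : ∀ᶠ t in 𝓝[>] (0 : ℝ), |w t| ≤ C)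
    (hvd : Tendsto (fun t => v t / sph lam (hyp t)) atTop (𝓝 0))
    (hwd : Tendsto (fun t => w t / sph lam (hyp t)) atTop (𝓝 0)) {t : ℝ} (ht : 0 < t) : v t = w t := by
  set d : ℝ → ℝ := fun t => v t - w t with hd
  have hdd : ∀ t, 0 < t → HasDerivAt d (v' t - w' t) t := fun t ht => (hv t ht).sub (hw t ht)
  have hdd' : ∀ t, 0 < t → HasDerivAt (fun t => v' t - w' t) (v'' t - w'' t) t :=
    fun t ht => (hv' t ht).sub (hw' t ht)
  have hdode : ∀ t, 0 < t → Real.sinh (2 * t) * (v'' t - w'' t) + 2 * Real.cosh (2 * t) * (v' t - w' t)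
      = lam * (lam - 2) * Real.sinh (2 * t) * d t := by
    intro t ht
    simp only [hd]
    linear_combination hvode t ht - hwode t ht
  have hdB : ∀ᶠ t in 𝓝[>] (0 : ℝ), |d t| ≤ B + C := by
    filter_upwards [hB, hC] with t h1 h2
    simp only [hd]
    exact le_trans (abs_sub _ _) (add_le_add h1 h2)
  have hrep : ∀ s, 0 < s → d s = (d 1 / sph lam (hyp 1)) * sph lam (hyp s) :=
    fun s hs => eq_const_mul_sph_of_bounded lam hdd hdd' hdode hdB hs
  have hddiv : Tendsto (fun s => d s / sph lam (hyp s)) atTop (𝓝 0) := by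
    have h := hvd.sub hwd
    rw [sub_zero] at h
    refine h.congr' (Eventually.of_forall fun s => ?_)
    simp only [hd]
    rw [sub_div]
  have hconst : Tendsto (fun s => d s / sph lam (hyp s)) atTop (𝓝 (d 1 / sph lam (hyp 1))) := by
    refine tendsto_const_nhds.congr' ?_
    filter_upwards [eventually_gt_atTop 0] with s hs
    rw [hrep s hs, mul_div_assoc, div_self (sph_hyp_pos lam s).ne', mul_one]
  have hk : d 1 / sph lam (hyp 1) = 0 := tendsto_nhds_unique hconst hddiv
  have hd0 : d t = 0 := by rw [hrep t ht, hk, zero_mul]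
  simp only [hd] at hd0
  linarith

/-! ### `χ_{λ₂}/φ_λ → 0` -/

/-- **`χ_{λ₂}(t)/φ_λ(a_t) → 0`** for `λ, λ₂ > 1` (`χ_{λ₂} ~ e^{−λ₂ t}`, `φ_λ ~ e^{(λ−2)t}`, `λ + λ₂ > 2`). -/
theorem tendsto_sphDecay_div_sph_hyp_atTop {lam lam₂ : ℝ} (hlam : 1 < lam) (hlam₂ : 1 < lam₂) :
    Tendsto (fun t => sphDecay lam₂ t / sph lam (hyp t)) atTop (𝓝 0) := by
  have hc : 0 < cfun (2 - lam) := cfun_pos (by linarith)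
  have hA := tendsto_exp_two_sub_mul_sph_hyp hlam
  have hB := tendsto_exp_mul_sphDecay hlam₂
  have hE : Tendsto (fun t => Real.exp ((2 - lam - lam₂) * t)) atTop (𝓝 0) := by
    have := Real.tendsto_exp_atBot.comp (tendsto_id.const_mul_atTop_of_neg (by linarith : 2 - lam - lam₂ < 0))
    simpa only [Function.comp_def, id] using this
  have h := (hB.div hA hc.ne').mul hE
  rw [mul_zero] at h
  refine h.congr' (Eventually.of_forall fun t => ?_)
  have hφ : sph lam (hyp t) ≠ 0 := (sph_hyp_pos lam t).ne'
  have hE1 : Real.exp ((2 - lam) * t) ≠ 0 := (Real.exp_pos _).ne'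
  have key : Real.exp (lam₂ * t) * Real.exp ((2 - lam - lam₂) * t) = Real.exp ((2 - lam) * t) := by
    rw [← Real.exp_add]
    congr 1
    ring
  show Real.exp (lam₂ * t) * sphDecay lam₂ t / (Real.exp ((2 - lam) * t) * sph lam (hyp t))
    * Real.exp ((2 - lam - lam₂) * t) = sphDecay lam₂ t / sph lam (hyp t)
  rw [← key]
  field_simp

variable {lam lam₂ a b : ℝ} {f : ℝ → ℝ} (hlam : 1 < lam) (hlam₂ : 1 < lam₂) (hf : ContinuousOn f (Ioi 0))
  (ha : 0 < a) (hab : a ≤ b) (hfa : ∀ s, s ≤ a → f s = 0) (hfb : ∀ s, b ≤ s → f s = 0)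

include hlam hlam₂ hf ha hab hfb in
/-- **`(G_{λ₂} f)/φ_λ → 0`** at infinity for every `λ, λ₂ > 1`. -/
theorem tendsto_sphGreen_div_sph_hyp_atTop :
    Tendsto (fun t => sphGreen lam₂ f a b t / sph lam (hyp t)) atTop (𝓝 0) := by
  have h := (tendsto_sphDecay_div_sph_hyp_atTop hlam hlam₂).const_mul
    (-(∫ s in a..b, sph lam₂ (hyp s) * f s * Real.sinh (2 * s)))
  rw [mul_zero] at h
  refine h.congr' ?_
  filter_upwards [eventually_ge_atTop b] with t ht
  rw [sphGreen_eq_of_ge hf ha hab hfb ht]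
  ring

/-! ### The difference of two resolvents -/

include hlam hlam₂ in
/-- **`(L − μ)(G_λ f − G_{λ₂} f) = (μ − μ₂) G_{λ₂} f`**: the difference solves the radial equation at `μ = λ(λ−2)`
with the source `(μ − μ₂) G_{λ₂} f`. -/
theorem resolvent_diff_ode {t : ℝ} (ht : 0 < t) :
    Real.sinh (2 * t) * (sphGreen'' lam f a b t - sphGreen'' lam₂ f a b t)
        + 2 * Real.cosh (2 * t) * (sphGreen' lam f a b t - sphGreen' lam₂ f a b t)
      = lam * (lam - 2) * Real.sinh (2 * t) * (sphGreen lam f a b t - sphGreen lam₂ f a b t)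
        + Real.sinh (2 * t) * ((lam * (lam - 2) - lam₂ * (lam₂ - 2)) * sphGreen lam₂ f a b t) := by
  have e1 := sphGreen_ode hlam (f := f) (a := a) (b := b) ht
  have e2 := sphGreen_ode hlam₂ (f := f) (a := a) (b := b) ht
  linear_combination e1 - e2

include hlam hlam₂ hf ha hab in
/-- The derivative data of the difference. -/
theorem hasDerivAt_resolvent_diff {t : ℝ} (ht : 0 < t) :
    HasDerivAt (fun t => sphGreen lam f a b t - sphGreen lam₂ f a b t)
      (sphGreen' lam f a b t - sphGreen' lam₂ f a b t) t :=
  (hasDerivAt_sphGreen hlam hf ha hab ht).sub (hasDerivAt_sphGreen hlam₂ hf ha hab ht)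

include hlam hlam₂ hf ha hab in
/-- The second-derivative data of the difference. -/
theorem hasDerivAt_resolvent_diff' {t : ℝ} (ht : 0 < t) :
    HasDerivAt (fun t => sphGreen' lam f a b t - sphGreen' lam₂ f a b t)
      (sphGreen'' lam f a b t - sphGreen'' lam₂ f a b t) t :=
  (hasDerivAt_sphGreen' hlam hf ha hab ht).sub (hasDerivAt_sphGreen' hlam₂ hf ha hab ht)

include hlam hlam₂ hf ha hab hfa in
/-- **The difference is bounded at the origin.** -/
theorem eventually_abs_resolvent_diff_le :
    ∀ᶠ t in 𝓝[>] (0 : ℝ), |sphGreen lam f a b t - sphGreen lam₂ f a b t|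
      ≤ (|∫ s in a..b, sphDecay lam s * f s * Real.sinh (2 * s)| + 1)
        + (|∫ s in a..b, sphDecay lam₂ s * f s * Real.sinh (2 * s)| + 1) := by
  filter_upwards [eventually_abs_sphGreen_le hlam hf ha hab hfa, eventually_abs_sphGreen_le hlam₂ hf ha hab hfa]
    with t h1 h2
  exact le_trans (abs_sub _ _) (add_le_add h1 h2)

include hlam hlam₂ hf ha hab hfb in
/-- **The difference decays relative to `φ_λ`.** -/
theorem tendsto_resolvent_diff_div_atTop :
    Tendsto (fun t => (sphGreen lam f a b t - sphGreen lam₂ f a b t) / sph lam (hyp t)) atTop (𝓝 0) := by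
  have h := (tendsto_sphGreen_div_atTop hlam hf ha hab hfb).sub
    (tendsto_sphGreen_div_sph_hyp_atTop hlam hlam₂ hf ha hab hfb)
  rw [sub_zero] at h
  refine h.congr' (Eventually.of_forall fun t => ?_)
  show _ = (sphGreen lam f a b t - sphGreen lam₂ f a b t) / sph lam (hyp t)
  rw [sub_div]

include hlam hlam₂ hf ha hab hfa hfb in
/-- **THE RESOLVENT IDENTITY IN ODE FORM**: `G_λ f − G_{λ₂} f` is the unique solution of
`(L − μ) v = (μ − μ₂) G_{λ₂} f` on `(0, ∞)` that is bounded at the origin and decays relative to `φ_λ` — it is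
`G_λ` applied to the source `(μ − μ₂) G_{λ₂} f`. -/
theorem eq_resolvent_diff_of_ode {v v' v'' : ℝ → ℝ}
    (hv : ∀ t, 0 < t → HasDerivAt v (v' t) t) (hv' : ∀ t, 0 < t → HasDerivAt v' (v'' t) t)
    (hvode : ∀ t, 0 < t → Real.sinh (2 * t) * v'' t + 2 * Real.cosh (2 * t) * v' t
      = lam * (lam - 2) * Real.sinh (2 * t) * v t
        + Real.sinh (2 * t) * ((lam * (lam - 2) - lam₂ * (lam₂ - 2)) * sphGreen lam₂ f a b t))
    {B : ℝ} (hB : ∀ᶠ t in 𝓝[>] (0 : ℝ), |v t| ≤ B)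
    (hdecay : Tendsto (fun t => v t / sph lam (hyp t)) atTop (𝓝 0)) {t : ℝ} (ht : 0 < t) :
    v t = sphGreen lam f a b t - sphGreen lam₂ f a b t :=
  eq_of_ode_of_bounded_of_decay lam hv hv' hvode (fun _ ht => hasDerivAt_resolvent_diff hlam hlam₂ hf ha hab ht)
    (fun _ ht => hasDerivAt_resolvent_diff' hlam hlam₂ hf ha hab ht)
    (fun _ ht => resolvent_diff_ode hlam hlam₂ (f := f) (a := a) (b := b) ht) hB
    (eventually_abs_resolvent_diff_le hlam hlam₂ hf ha hab hfa) hdecay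
    (tendsto_resolvent_diff_div_atTop hlam hlam₂ hf ha hab hfb) ht

/-! ### The transform picture -/

include hf ha hab hfa hfb in
/-- **THE RESOLVENT IDENTITY IN THE TRANSFORM PICTURE**: for `|λ′ − 1| < λ − 1` and `|λ′ − 1| < λ₂ − 1`,
`(G_λ f)^(λ′) − (G_{λ₂} f)^(λ′) = (μ − μ₂) f̂(λ′)/((μ′ − μ)(μ′ − μ₂))`, `μ′ = λ′(λ′−2)`. -/
theorem resolvent_identity_transform {lam' : ℝ} (h₁ : |lam' - 1| < lam - 1) (h₂ : |lam' - 1| < lam₂ - 1) :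
    (∫ t in Ioi 0, sphGreen lam f a b t * sph lam' (hyp t) * Real.sinh (2 * t))
        - (∫ t in Ioi 0, sphGreen lam₂ f a b t * sph lam' (hyp t) * Real.sinh (2 * t))
      = (lam * (lam - 2) - lam₂ * (lam₂ - 2)) * (∫ t in Ioi 0, f t * sph lam' (hyp t) * Real.sinh (2 * t))
        / ((lam' * (lam' - 2) - lam * (lam - 2)) * (lam' * (lam' - 2) - lam₂ * (lam₂ - 2))) := by
  rw [resolvent_diag_strip hf ha hab hfa hfb h₁, resolvent_diag_strip hf ha hab hfa hfb h₂]
  have hne₁ : (lam' - 1) ^ 2 - (lam - 1) ^ 2 ≠ 0 := by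
    rw [← mu_sub_mu_eq]
    exact (mu_sub_mu_neg_of_abs_lt h₁).ne
  have hne₂ : (lam' - 1) ^ 2 - (lam₂ - 1) ^ 2 ≠ 0 := by
    rw [← mu_sub_mu_eq]
    exact (mu_sub_mu_neg_of_abs_lt h₂).ne
  rw [mu_sub_mu_eq lam lam', mu_sub_mu_eq lam₂ lam']
  field_simp
  ring

end measure

end Summit.Ventures.HodgeRepro2.T5SU11ResolventIdentity
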